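import Summits.HodgeConjecture.HodgeConjecture.Theorems.Ring2HypothesesMultiWeilVsPullbacks
import Summits.HodgeConjecture.HodgeConjecture.Theorems.Ring2ClassTargetsWeilPullbackGenerated
import HarnessLib

/-!
# Ring 2 · hypotheses layer, part XX — member shapes DESCEND ALONG SLICES of a product (the kernel Künneth bridge)

HONEST FRAMING (cell `pub-hodge-ring2`, verbatim): research route conditional on HC_CM; not a corollary;
Q11.4-sentence-2 already refuted in dim ≥ 3.

`HC_CM` := `Theses.RankFourFaces.CMAbelianHodge` does NOT occur in this file; no named fact is used except, in ONE
theorem, Weil's barrier fact `Weil1977_exceptionalHodgeClasses` AS A HYPOTHESIS. No definition, no `sorry`.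
Typer 2, gen 12, owed item o1 of RING2-MAP `## §hypotheses gen 11` ("kernel Künneth bridge": type reading rule r5
and the member lists of the obstructions O1, O2, which part XIX could state only over ONE exceptional class of the
member itself).

THE BRIDGE. No Künneth decomposition is needed: for abelian varieties `A'`, `A` and morphisms `i : A'.X ⟶ A.X`,
`r : A.X ⟶ A'.X` with `i ≫ r = 𝟙` (a RETRACT; e.g. `A = T × Y`, `A' = Y`, `r = pr₂`, `i = ({0} × Y ↪ T × Y)`, or
`A' = T` with the slice `sliceAt`), the pull-back `i^*` is a ring map taking rational classes to rational classes,
type `(p,q)` to type `(p,q)` (`IsOfHodgeType.map_of_isSmoothProjective`), divisor monomials to divisor monomials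
(§1 `map_mem_divisorMonomials`, new), André's codimension-2 Weil pull-backs to André pull-backs (§1, composition of
the structure map), and `i^* r^* = id`. Hence every typed MEMBER SHAPE of parts XIV, XIX and of typer 1's p194357
DESCENDS from `A` to the retract `A'` (§2): `B = D` (`IsDivisorGenerated`), (P₂) `IsCodimTwoGeneratedBy` (seeds
pushed along `i^*`), (P₃) `IsCodimThreeProductGenerated`, (P) `IsWeilPullbackGenerated`, and (G)
`IsDivisorMultiWeilGenerated` OFF the middle degree of `A` (as `Bᵖ(A') ⊗ ℂ ⊆ Dᵖ(A') ⊗ ℂ`). Contrapositively an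
EXCEPTIONAL class of a factor (`∉ Dᵖ ⊗ ℂ`, rational, `(p,p)`) pulls back to an exceptional class of the product (§3).

THE ROWS THIS TYPES (§4; `T`, `Y` abelian varieties, `T × Y := T.prod Y`; every shape a HYPOTHESIS on the member):
* r5 (gen 11, was INFERENCE, now KERNEL): if `dim Y = 6`, `Y` satisfies (G) and carries ONE rational `(3,3)` class
  outside `D³ ⊗ ℂ` (print members: the general imaginary-quadratic Weil sixfolds, van Geemen Thm. 6.12 and 4.11),
  then for EVERY `T`: `¬ IsCodimThreeProductGenerated (T × Y)` and `¬ IsWeilPullbackGenerated (T × Y)`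
  (`not_isWeilPullbackGenerated_prod_of_multiWeil_of_exceptional_three`); and if moreover `0 < dim T` then also
  `¬ IsDivisorMultiWeilGenerated (T × Y)` (`not_isDivisorMultiWeilGenerated_prod_of_exceptional_middle`: the class
  `pr₂^* w` sits OFF the middle degree of `T × Y`, where (G) allows divisors only). So the dim-7 twins `E × Y₆` of the
  atlas (rows β, `B ≠ D`) are served by NEITHER member shape — table XIX.2's "neither" column is now a theorem
  schema (`prod_weilSixfold_neither_shape`); what covers them is the census X1 ∧ X2′, whose lower-dimension and
  Weil-sixfold pull-back summands contain `pr₂^* w` tautologically (`map_snd_mem_lowerDimPullbacks`,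
  `map_snd_mem_weilSixfoldPullbacks`).
* O2 members UP the tower: one rational `(2,2)` class outside `D² ⊗ ℂ` on `Y` kills (G) on every `T × Y` of
  dimension `≠ 4` and kills `B = D` on every `T × Y` (§3, §4).
* From Weil's barrier fact alone (`n = 3`, hypothesis): a sixfold `Y` with `¬ IsDivisorMultiWeilGenerated (T × Y)`
  for every positive-dimensional `T` and `¬ IsDivisorGenerated (T × Y)` for every `T` (§4).
What does NOT descend: the X2 and X2′ summand of pull-backs from LOWER dimension (the bound `dim C < dim A` is
relative to the ambient variety) — not claimed; nor (G) in the middle degree. What this file does NOT do: decide any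
shape for any member; prove `W₆`, the floor, R3 or `HC_CM`; touch any route item. Honest column: functoriality of
pull-back (Hatcher 3.10, Voisin 7.3.2, Fulton §10.1 slices) applied to the typed predicates; member lists labelled
print (vG 6.12 and 4.11, MZ §5).

References: [cite: vanGeemen1994HodgeAV, §2.4–2.5, 4.9–4.11, Thm. 6.12] [cite: MoonenZarhin1999LowDim, Thm. 0.2
(e),(f), (2.7)–(2.8) and §5] [cite: Fulton1998, §10.1 and §19.2 Cor. 19.2 (b)] [cite: VoisinHodgeI2002, §7.3.2 and
Thm. 11.30] [cite: HatcherAT2002, §3.2 Prop. 3.10] [cite: Weil1977HodgeRing] [cite: Andre1992HodgeCM, Théorème]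
-/

set_option linter.dupNamespace false

noncomputable section

open CategoryTheory MonoidalCategory
open Literature.AlgebraicGeometry Literature.AlgebraicGeometry.Motives
open Literature.AlgebraicGeometry.HodgeTheory
open Literature.AlgebraicTopology.SingularHomology
open Literature.Barriers.HodgeConjecture (divisorMonomials divisorClassesSpan mem_divisorMonomials_zero
  mem_divisorMonomials_succ Weil1977_exceptionalHodgeClasses)
open Summit.HodgeConjecture.HodgeConjecture.Theses
open Summit.HodgeConjecture.HodgeConjecture.Ring2.ClassTargets

namespace Summit.HodgeConjecture.HodgeConjecture.Ring2.Hypotheses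

/-! ## §1 Pull-back functoriality of the typed ingredients -/

section Functoriality

variable {X X' : SchemeOver ℂ} {N N' : ℕ}

/-- **Divisor monomials pull back to divisor monomials** along any morphism of smooth projective varieties:
`f^*(b₁ ∪ ⋯ ∪ b_m) = f^*b₁ ∪ ⋯ ∪ f^*b_m` with each `f^*bᵢ` rational of type `(1,1)`.
[cite: HatcherAT2002, §3.2 Prop. 3.10] [cite: VoisinHodgeI2002, §7.3.2] [cite: vanGeemen1994HodgeAV, §2.4] -/
theorem map_mem_divisorMonomials (hX : IsSmoothProjective N X) (hX' : IsSmoothProjective N' X') (f : X' ⟶ X)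
    {m : ℕ} {c : complexBetti X (2 * m)} (hc : c ∈ divisorMonomials X N m) :
    complexBetti.map f (2 * m) c ∈ divisorMonomials X' N' m := by
  induction m with
  | zero =>
    rw [mem_divisorMonomials_zero] at hc ⊢
    subst hc
    exact singularCohomology.map_one _
  | succ m ih =>
    obtain ⟨a, ha, b, hb, hb', rfl⟩ := mem_divisorMonomials_succ.1 hc
    exact mem_divisorMonomials_succ.2 ⟨complexBetti.map f (2 * m) a, ih ha, complexBetti.map f 2 b, hb.pullback _,
      hb'.map_of_isSmoothProjective hX' hX f, complexBetti.map_cupProduct f _ a b⟩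

/-- **`f^*(Dᵐ(X) ⊗ ℂ) ⊆ Dᵐ(X') ⊗ ℂ`.** [cite: vanGeemen1994HodgeAV, §2.4] [cite: HatcherAT2002, §3.2 Prop. 3.10] -/
theorem map_mem_divisorClassesSpan (hX : IsSmoothProjective N X) (hX' : IsSmoothProjective N' X') (f : X' ⟶ X)
    {m : ℕ} {c : complexBetti X (2 * m)} (hc : c ∈ divisorClassesSpan X N m) :
    complexBetti.map f (2 * m) c ∈ divisorClassesSpan X' N' m := by
  induction hc using Submodule.span_induction with
  | mem x hx => exact Submodule.subset_span (map_mem_divisorMonomials hX hX' f hx)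
  | zero => rw [map_zero]; exact zero_mem _
  | add x y _ _ hx hy => rw [map_add]; exact add_mem hx hy
  | smul a x _ hx => rw [map_smul]; exact Submodule.smul_mem _ a hx

end Functoriality

variable {A A' : AbelianVariety ℂ}

/-- The product summand `B² ⌣ B¹` of (P₃) and X1 (verbatim typer 1's and the census's set) is stable under `i^*`.
[cite: HatcherAT2002, §3.2 Prop. 3.10] [cite: MoonenZarhin1999LowDim, §2] -/
theorem map_mem_span_codimTwo_cup_codimOne (i : A'.X ⟶ A.X) {c : complexBetti A.X (2 * 3)}
    (hc : c ∈ Submodule.span ℂ {w' : complexBetti A.X (2 * 3) |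
      ∃ (a : complexBetti A.X (2 * 2)) (b : complexBetti A.X (2 * 1)),
        IsRationalClass a ∧ IsOfHodgeType A.dim A.X (2 * 2) 2 2 a ∧ IsRationalClass b ∧
        IsOfHodgeType A.dim A.X (2 * 1) 1 1 b ∧ w' = cupProduct (two_mul_add_two_mul 2 1) a b}) :
    complexBetti.map i (2 * 3) c ∈ Submodule.span ℂ {w' : complexBetti A'.X (2 * 3) |
      ∃ (a : complexBetti A'.X (2 * 2)) (b : complexBetti A'.X (2 * 1)),
        IsRationalClass a ∧ IsOfHodgeType A'.dim A'.X (2 * 2) 2 2 a ∧ IsRationalClass b ∧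
        IsOfHodgeType A'.dim A'.X (2 * 1) 1 1 b ∧ w' = cupProduct (two_mul_add_two_mul 2 1) a b} := by
  have hA : IsSmoothProjective A.dim A.X := Motives.AbelianVariety.isSmoothProjective_holds
  have hA' : IsSmoothProjective A'.dim A'.X := Motives.AbelianVariety.isSmoothProjective_holds
  induction hc using Submodule.span_induction with
  | mem x hx =>
    obtain ⟨a, b, ha, hat, hb, hbt, rfl⟩ := hx
    exact Submodule.subset_span ⟨complexBetti.map i (2 * 2) a, complexBetti.map i (2 * 1) b, ha.pullback _,
      hat.map_of_isSmoothProjective hA' hA i, hb.pullback _, hbt.map_of_isSmoothProjective hA' hA i,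
      complexBetti.map_cupProduct i _ a b⟩
  | zero => rw [map_zero]; exact zero_mem _
  | add x y _ _ hx hy => rw [map_add]; exact add_mem hx hy
  | smul a x _ hx => rw [map_smul]; exact Submodule.smul_mem _ a hx

/-- **André's codimension-2 Weil pull-backs pull back to André pull-backs**: `i^*(g^*ω) = (i ≫ g)^*ω`, both
alternatives of `codimTwoWeilPullbacks` being closed under composition of the structure map `g`.
[cite: Andre1992HodgeCM, Théorème] [cite: HatcherAT2002, §3.2 Prop. 3.10] -/
theorem map_mem_codimTwoWeilPullbacks (i : A'.X ⟶ A.X) {c : complexBetti A.X (2 * 2)}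
    (hc : c ∈ codimTwoWeilPullbacks A) : complexBetti.map i (2 * 2) c ∈ codimTwoWeilPullbacks A' := by
  rcases hc with ⟨B, g, d, ψ, w, hB, hd, hψ, hw, hwt, hwW, rfl⟩ |
    ⟨B, g, ψ, P, e, w, hP, hPe, he, hirr, hψP, heB, hroots, hQ, hwW, hw, hwt, rfl⟩
  · exact Or.inl ⟨B, i ≫ g, d, ψ, w, hB, hd, hψ, hw, hwt, hwW, (complexBetti.map_comp_apply' i g (2 * 2) w).symm⟩
  · exact Or.inr ⟨B, i ≫ g, ψ, P, e, w, hP, hPe, he, hirr, hψP, heB, hroots, hQ, hwW, hw, hwt,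
      (complexBetti.map_comp_apply' i g (2 * 2) w).symm⟩

/-- Spans of André pull-backs pull back into spans of André pull-backs. [cite: Andre1992HodgeCM, Théorème] -/
theorem map_mem_span_codimTwoWeilPullbacks (i : A'.X ⟶ A.X) {c : complexBetti A.X (2 * 2)}
    (hc : c ∈ Submodule.span ℂ (codimTwoWeilPullbacks A)) :
    complexBetti.map i (2 * 2) c ∈ Submodule.span ℂ (codimTwoWeilPullbacks A') := by
  induction hc using Submodule.span_induction with
  | mem x hx => exact Submodule.subset_span (map_mem_codimTwoWeilPullbacks i hx)
  | zero => rw [map_zero]; exact zero_mem _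
  | add x y _ _ hx hy => rw [map_add]; exact add_mem hx hy
  | smul a x _ hx => rw [map_smul]; exact Submodule.smul_mem _ a hx

/-! ## §2 DESCENT of the member shapes to a retract `i : A' ⟶ A`, `r : A ⟶ A'`, `i ≫ r = 𝟙` -/

section Retract

variable (i : A'.X ⟶ A.X) (r : A.X ⟶ A'.X)

/-- `i^* r^* = id` on cohomology. [cite: HatcherAT2002, §3.1] -/
theorem map_map_of_retract (hir : i ≫ r = 𝟙 A'.X) (k : ℕ) (c : complexBetti A'.X k) :
    complexBetti.map i k (complexBetti.map r k c) = c := by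
  rw [← complexBetti.map_comp_apply', hir, complexBetti.map_id]
  rfl

variable {i r}

/-- **`B = D` DESCENDS to a retract** (e.g. to each factor of a product).
[cite: vanGeemen1994HodgeAV, §2.4–2.5] [cite: Fulton1998, §10.1] -/
theorem isDivisorGenerated_of_retract (hir : i ≫ r = 𝟙 A'.X) (hD : IsDivisorGenerated A) : IsDivisorGenerated A' := by
  intro p c hc hH
  have hA : IsSmoothProjective A.dim A.X := Motives.AbelianVariety.isSmoothProjective_holds
  have hA' : IsSmoothProjective A'.dim A'.X := Motives.AbelianVariety.isSmoothProjective_holds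
  rw [← map_map_of_retract i r hir (2 * p) c]
  exact map_mem_divisorClassesSpan hA hA' i
    (hD p (complexBetti.map r (2 * p) c) (hc.pullback _) (hH.map_of_isSmoothProjective hA hA' r))

/-- **(P₂) DESCENDS to a retract, seeds pushed along `i^*`.** [cite: MoonenZarhin1999LowDim, Thm. 0.2 (e),(f), §5] -/
theorem isCodimTwoGeneratedBy_of_retract (hir : i ≫ r = 𝟙 A'.X) {S : Set (complexBetti A.X (2 * 2))}
    (hP : IsCodimTwoGeneratedBy A S) : IsCodimTwoGeneratedBy A' (complexBetti.map i (2 * 2) '' S) := by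
  intro c hc hH
  have hA : IsSmoothProjective A.dim A.X := Motives.AbelianVariety.isSmoothProjective_holds
  have hA' : IsSmoothProjective A'.dim A'.X := Motives.AbelianVariety.isSmoothProjective_holds
  obtain ⟨y, hy, z, hz, hyz⟩ := Submodule.mem_sup.1
    (hP (complexBetti.map r (2 * 2) c) (hc.pullback _) (hH.map_of_isSmoothProjective hA hA' r))
  rw [← map_map_of_retract i r hir (2 * 2) c, ← hyz, map_add]
  exact Submodule.mem_sup.2 ⟨_, map_mem_divisorClassesSpan hA hA' i hy, _,
    (Submodule.map_span _ _).le (Submodule.mem_map_of_mem hz), rfl⟩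

/-- **(P₃) `IsCodimThreeProductGenerated` DESCENDS to a retract.** [cite: MoonenZarhin1999LowDim, §2 and §5] -/
theorem isCodimThreeProductGenerated_of_retract (hir : i ≫ r = 𝟙 A'.X) (hP : IsCodimThreeProductGenerated A) :
    IsCodimThreeProductGenerated A' := by
  intro c hc hH
  have hA : IsSmoothProjective A.dim A.X := Motives.AbelianVariety.isSmoothProjective_holds
  have hA' : IsSmoothProjective A'.dim A'.X := Motives.AbelianVariety.isSmoothProjective_holds
  obtain ⟨y, hy, z, hz, hyz⟩ := Submodule.mem_sup.1
    (hP (complexBetti.map r (2 * 3) c) (hc.pullback _) (hH.map_of_isSmoothProjective hA hA' r))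
  rw [← map_map_of_retract i r hir (2 * 3) c, ← hyz, map_add]
  exact Submodule.mem_sup.2 ⟨_, map_mem_divisorClassesSpan hA hA' i hy, _, map_mem_span_codimTwo_cup_codimOne i hz, rfl⟩

/-- **(P) `IsWeilPullbackGenerated` DESCENDS to a retract** (André pull-backs are stable under `i^*`).
[cite: Andre1992HodgeCM, Théorème] [cite: MoonenZarhin1999LowDim, §5] -/
theorem isWeilPullbackGenerated_of_retract (hir : i ≫ r = 𝟙 A'.X) (hP : IsWeilPullbackGenerated A) :
    IsWeilPullbackGenerated A' := by
  refine ⟨fun c hc hH ↦ ?_, isCodimThreeProductGenerated_of_retract hir hP.2⟩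
  have hA : IsSmoothProjective A.dim A.X := Motives.AbelianVariety.isSmoothProjective_holds
  have hA' : IsSmoothProjective A'.dim A'.X := Motives.AbelianVariety.isSmoothProjective_holds
  obtain ⟨y, hy, z, hz, hyz⟩ := Submodule.mem_sup.1
    (hP.1 (complexBetti.map r (2 * 2) c) (hc.pullback _) (hH.map_of_isSmoothProjective hA hA' r))
  rw [← map_map_of_retract i r hir (2 * 2) c, ← hyz, map_add]
  exact Submodule.mem_sup.2 ⟨_, map_mem_divisorClassesSpan hA hA' i hy, _, map_mem_span_codimTwoWeilPullbacks i hz, rfl⟩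

/-- **(G) DESCENDS OFF THE MIDDLE DEGREE of `A`**: `IsDivisorMultiWeilGenerated A` and `dim A ≠ 2p` give
`Bᵖ(A') ⊗ ℂ ⊆ Dᵖ(A') ⊗ ℂ` on every retract `A'` (the Weil planes of `A` live in degree `dim A` only).
[cite: vanGeemen1994HodgeAV, 4.9 and §2.4–2.5] -/
theorem mem_divisorClassesSpan_of_retract_of_isDivisorMultiWeilGenerated_off_middle (hir : i ≫ r = 𝟙 A'.X)
    (hG : IsDivisorMultiWeilGenerated A) {p : ℕ} (hp : A.dim ≠ 2 * p) {c : complexBetti A'.X (2 * p)}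
    (hc : IsRationalClass c) (hH : IsOfHodgeType A'.dim A'.X (2 * p) p p c) : c ∈ divisorClassesSpan A'.X A'.dim p := by
  have hA : IsSmoothProjective A.dim A.X := Motives.AbelianVariety.isSmoothProjective_holds
  have hA' : IsSmoothProjective A'.dim A'.X := Motives.AbelianVariety.isSmoothProjective_holds
  rw [← map_map_of_retract i r hir (2 * p) c]
  exact map_mem_divisorClassesSpan hA hA' i (mem_divisorClassesSpan_of_isDivisorMultiWeilGenerated_off_middle hG hp
    (c := complexBetti.map r (2 * p) c) (hc.pullback _) (hH.map_of_isSmoothProjective hA hA' r))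

/-- **(G) on an ODD-dimensional `A` gives `B = D` on every retract.** [cite: vanGeemen1994HodgeAV, 4.9] -/
theorem isDivisorGenerated_of_retract_of_isDivisorMultiWeilGenerated_of_odd (hir : i ≫ r = 𝟙 A'.X)
    (hG : IsDivisorMultiWeilGenerated A) (hA : Odd A.dim) : IsDivisorGenerated A' :=
  isDivisorGenerated_of_retract hir ((isDivisorMultiWeilGenerated_iff_isDivisorGenerated_of_odd_dim hA).1 hG)

/-! ## §3 UPWARD: an exceptional class of the retract is an exceptional class of `A` -/

/-- **`r^*` of a class outside `Dᵖ(A') ⊗ ℂ` lies outside `Dᵖ(A) ⊗ ℂ`** (and stays rational of type `(p,p)`).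
[cite: vanGeemen1994HodgeAV, §2.4 and Thm. 4.11] -/
theorem map_not_mem_divisorClassesSpan_of_retract (hir : i ≫ r = 𝟙 A'.X) {p : ℕ} {c : complexBetti A'.X (2 * p)}
    (hn : c ∉ divisorClassesSpan A'.X A'.dim p) : complexBetti.map r (2 * p) c ∉ divisorClassesSpan A.X A.dim p := by
  intro h
  have hA : IsSmoothProjective A.dim A.X := Motives.AbelianVariety.isSmoothProjective_holds
  have hA' : IsSmoothProjective A'.dim A'.X := Motives.AbelianVariety.isSmoothProjective_holds
  exact hn (map_map_of_retract i r hir (2 * p) c ▸ map_mem_divisorClassesSpan hA hA' i h)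

/-- **`B ≠ D` goes UP**: one rational `(p,p)` class outside `Dᵖ ⊗ ℂ` on a retract kills `IsDivisorGenerated A`.
[cite: vanGeemen1994HodgeAV, §2.5] -/
theorem not_isDivisorGenerated_of_retract_of_exceptional (hir : i ≫ r = 𝟙 A'.X) {p : ℕ}
    {c : complexBetti A'.X (2 * p)} (hc : IsRationalClass c) (hH : IsOfHodgeType A'.dim A'.X (2 * p) p p c)
    (hn : c ∉ divisorClassesSpan A'.X A'.dim p) : ¬ IsDivisorGenerated A :=
  fun hD ↦ hn (isDivisorGenerated_of_retract hir hD p c hc hH)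

/-- **O2 UP the tower**: one rational `(p,p)` class outside `Dᵖ ⊗ ℂ` on a retract, with `2p ≠ dim A`, kills (G)
on `A`. [cite: MoonenZarhin1999LowDim, Thm. 0.2 (e),(f) and §5] [cite: vanGeemen1994HodgeAV, 4.9] -/
theorem not_isDivisorMultiWeilGenerated_of_retract_of_exceptional_off_middle (hir : i ≫ r = 𝟙 A'.X) {p : ℕ}
    (hp : A.dim ≠ 2 * p) {c : complexBetti A'.X (2 * p)} (hc : IsRationalClass c)
    (hH : IsOfHodgeType A'.dim A'.X (2 * p) p p c) (hn : c ∉ divisorClassesSpan A'.X A'.dim p) :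
    ¬ IsDivisorMultiWeilGenerated A :=
  fun hG ↦ hn (mem_divisorClassesSpan_of_retract_of_isDivisorMultiWeilGenerated_off_middle hir hG hp hc hH)

/-- **(P₃) and (P) fail UP the tower** as soon as (P₃) fails on a retract. [cite: MoonenZarhin1999LowDim, §5] -/
theorem not_isWeilPullbackGenerated_of_retract (hir : i ≫ r = 𝟙 A'.X) (h : ¬ IsCodimThreeProductGenerated A') :
    ¬ IsCodimThreeProductGenerated A ∧ ¬ IsWeilPullbackGenerated A :=
  ⟨fun hP ↦ h (isCodimThreeProductGenerated_of_retract hir hP),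
    fun hP ↦ h (isCodimThreeProductGenerated_of_retract hir hP.2)⟩

end Retract

/-! ## §4 PRODUCTS `T × Y`: the two slices, and the rows of table XIX.2 this types -/

section Product

variable (T Y : AbelianVariety ℂ)

/-- The slice `{0} × Y ↪ T × Y` is a section of `pr₂` (the slice `T × {0}` is the tree's `sliceAt`, section of `pr₁`
by `sliceAt_fst`). [cite: Fulton1998, §10.1] -/
theorem rightSlice_snd :
    CartesianMonoidalCategory.lift (toSpecOver Y.X ≫ (1 : T.Points ℂ)) (𝟙 Y.X) ≫ CartesianMonoidalCategory.snd T.X Y.X =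
      𝟙 Y.X :=
  CartesianMonoidalCategory.lift_snd _ _

variable {T Y}

/-- **Every member shape of `T × Y` descends to BOTH factors**: `B = D`, (P₃), (P).
[cite: vanGeemen1994HodgeAV, §2.4–2.5] [cite: MoonenZarhin1999LowDim, §3 (3.1) and §5] -/
theorem shapes_of_prod :
    (IsDivisorGenerated (T.prod Y) → IsDivisorGenerated T ∧ IsDivisorGenerated Y) ∧
    (IsCodimThreeProductGenerated (T.prod Y) → IsCodimThreeProductGenerated T ∧ IsCodimThreeProductGenerated Y) ∧
    (IsWeilPullbackGenerated (T.prod Y) → IsWeilPullbackGenerated T ∧ IsWeilPullbackGenerated Y) :=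
  ⟨fun h ↦ ⟨isDivisorGenerated_of_retract (A := T.prod Y) (sliceAt_fst T.X (1 : Y.Points ℂ)) h,
      isDivisorGenerated_of_retract (A := T.prod Y) (rightSlice_snd T Y) h⟩,
    fun h ↦ ⟨isCodimThreeProductGenerated_of_retract (A := T.prod Y) (sliceAt_fst T.X (1 : Y.Points ℂ)) h,
      isCodimThreeProductGenerated_of_retract (A := T.prod Y) (rightSlice_snd T Y) h⟩,
    fun h ↦ ⟨isWeilPullbackGenerated_of_retract (A := T.prod Y) (sliceAt_fst T.X (1 : Y.Points ℂ)) h,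
      isWeilPullbackGenerated_of_retract (A := T.prod Y) (rightSlice_snd T Y) h⟩⟩

/-- **An exceptional MIDDLE class of `Y` kills (G) on `T × Y` for every positive-dimensional `T`** (`pr₂^* w` is
off the middle degree `dim T + dim Y` of the product, where (G) allows divisors only). Members (print): `Y` a
general imaginary-quadratic Weil `2p`-fold, `T` anything, e.g. the dim-7 twins `E × Y₆` of the atlas.
[cite: vanGeemen1994HodgeAV, Thm. 4.11 and 4.9] [cite: MoonenZarhin1999LowDim, §5] -/
theorem not_isDivisorMultiWeilGenerated_prod_of_exceptional_middle (hT : 0 < T.dim) {p : ℕ} (hY : Y.dim = 2 * p)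
    {c : complexBetti Y.X (2 * p)} (hc : IsRationalClass c) (hH : IsOfHodgeType Y.dim Y.X (2 * p) p p c)
    (hn : c ∉ divisorClassesSpan Y.X Y.dim p) : ¬ IsDivisorMultiWeilGenerated (T.prod Y) :=
  not_isDivisorMultiWeilGenerated_of_retract_of_exceptional_off_middle (A := T.prod Y) (rightSlice_snd T Y)
    (by rw [Motives.AbelianVariety.dim_prod]; omega) hc hH hn

/-- **An exceptional class of `Y` (any degree) kills `B = D` on every `T × Y`.** [cite: vanGeemen1994HodgeAV, §2.5] -/
theorem not_isDivisorGenerated_prod_of_exceptional {p : ℕ} {c : complexBetti Y.X (2 * p)} (hc : IsRationalClass c)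
    (hH : IsOfHodgeType Y.dim Y.X (2 * p) p p c) (hn : c ∉ divisorClassesSpan Y.X Y.dim p) :
    ¬ IsDivisorGenerated (T.prod Y) :=
  not_isDivisorGenerated_of_retract_of_exceptional (A := T.prod Y) (rightSlice_snd T Y) hc hH hn

/-- **O2 UP: one rational `(2,2)` class of `Y` outside `D² ⊗ ℂ` kills (G) on every `T × Y` of dimension `≠ 4`**
(members: `T ×` a Moonen–Zarhin fourfold; `T ×` a K3-partner sixfold — cell computation K3-WP, not a tree theorem).
[cite: MoonenZarhin1999LowDim, Thm. 0.2 (e),(f) and §5] -/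
theorem not_isDivisorMultiWeilGenerated_prod_of_exceptional_two (hTY : T.dim + Y.dim ≠ 4)
    {c : complexBetti Y.X (2 * 2)} (hc : IsRationalClass c) (hH : IsOfHodgeType Y.dim Y.X (2 * 2) 2 2 c)
    (hn : c ∉ divisorClassesSpan Y.X Y.dim 2) : ¬ IsDivisorMultiWeilGenerated (T.prod Y) :=
  not_isDivisorMultiWeilGenerated_of_retract_of_exceptional_off_middle (A := T.prod Y) (rightSlice_snd T Y)
    (by rw [Motives.AbelianVariety.dim_prod]; omega) hc hH hn

/-- **r5 IN THE KERNEL: (P₃) and (P) fail on `T × Y₆` for EVERY `T`** when `Y₆` is a (G)-sixfold with ONE rational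
`(3,3)` class outside `D³ ⊗ ℂ` (its own Weil classes: van Geemen Thm. 6.12 and 4.11), because (P₃) would descend
to `Y₆`, where part XIX's (O1) forbids it. [cite: vanGeemen1994HodgeAV, Thm. 6.12 and Thm. 4.11]
[cite: MoonenZarhin1999LowDim, §5] [cite: Weil1977HodgeRing] -/
theorem not_isWeilPullbackGenerated_prod_of_multiWeil_of_exceptional_three (T : AbelianVariety ℂ) (hY : Y.dim = 6)
    (hG : IsDivisorMultiWeilGenerated Y) {c : complexBetti Y.X (2 * 3)} (hc : IsRationalClass c)
    (hH : IsOfHodgeType Y.dim Y.X (2 * 3) 3 3 c) (hn : c ∉ divisorClassesSpan Y.X Y.dim 3) :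
    ¬ IsCodimThreeProductGenerated (T.prod Y) ∧ ¬ IsWeilPullbackGenerated (T.prod Y) :=
  not_isWeilPullbackGenerated_of_retract (A := T.prod Y) (rightSlice_snd T Y)
    (not_productClause_of_isDivisorMultiWeilGenerated_of_exceptional_three hY hG hc hH hn)

/-- The same with the Weil sixfold as the LEFT factor, `Y₆ × T`. [cite: vanGeemen1994HodgeAV, Thm. 6.12] -/
theorem not_isWeilPullbackGenerated_prod_left_of_multiWeil_of_exceptional_three (T : AbelianVariety ℂ)
    (hY : Y.dim = 6) (hG : IsDivisorMultiWeilGenerated Y) {c : complexBetti Y.X (2 * 3)} (hc : IsRationalClass c)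
    (hH : IsOfHodgeType Y.dim Y.X (2 * 3) 3 3 c) (hn : c ∉ divisorClassesSpan Y.X Y.dim 3) :
    ¬ IsCodimThreeProductGenerated (Y.prod T) ∧ ¬ IsWeilPullbackGenerated (Y.prod T) :=
  not_isWeilPullbackGenerated_of_retract (A := Y.prod T) (sliceAt_fst Y.X (1 : T.Points ℂ))
    (not_productClause_of_isDivisorMultiWeilGenerated_of_exceptional_three hY hG hc hH hn)

/-- **TABLE XIX.2's "NEITHER" COLUMN, as a theorem schema**: for a (G)-sixfold `Y₆` with one rational `(3,3)` class
outside `D³ ⊗ ℂ` and ANY positive-dimensional `T`, the product `T × Y₆` satisfies NEITHER (G) NOR (P) NOR `B = D`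
(so neither part XIV's engine, price `W₆`, nor typer 1's engine, price R3 or the floor, serves it; only the census
rows X2′ ∧ X1 with their pull-back summands do). [cite: vanGeemen1994HodgeAV, Thm. 6.12 and 4.9]
[cite: MoonenZarhin1999LowDim, (2.7)–(2.8) and §5] -/
theorem prod_weilSixfold_neither_shape (hT : 0 < T.dim) (hY : Y.dim = 6) (hG : IsDivisorMultiWeilGenerated Y)
    {c : complexBetti Y.X (2 * 3)} (hc : IsRationalClass c) (hH : IsOfHodgeType Y.dim Y.X (2 * 3) 3 3 c)
    (hn : c ∉ divisorClassesSpan Y.X Y.dim 3) :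
    ¬ IsDivisorMultiWeilGenerated (T.prod Y) ∧ ¬ IsWeilPullbackGenerated (T.prod Y) ∧ ¬ IsDivisorGenerated (T.prod Y) :=
  ⟨not_isDivisorMultiWeilGenerated_prod_of_exceptional_middle hT hY hc hH hn,
    (not_isWeilPullbackGenerated_prod_of_multiWeil_of_exceptional_three T hY hG hc hH hn).2,
    not_isDivisorGenerated_prod_of_exceptional hc hH hn⟩

/-- **A class pulled back from the factor `Y` lies in the census's LOWER-DIMENSION pull-back summand of `T × Y`**
(X1's third, X2's and X2′'s second summand, generator shape verbatim) as soon as `0 < dim T`: tautological, no Weil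
structure needed. [cite: MoonenZarhin1999LowDim, (2.7)–(2.8)] -/
theorem map_snd_mem_lowerDimPullbacks (hT : 0 < T.dim) {p : ℕ} {w : complexBetti Y.X (2 * p)}
    (hw : IsRationalClass w) (hwt : IsOfHodgeType Y.dim Y.X (2 * p) p p w) :
    complexBetti.map (CartesianMonoidalCategory.snd T.X Y.X) (2 * p) w ∈ {w' : complexBetti (T.prod Y).X (2 * p) |
      ∃ (C : AbelianVariety ℂ) (g : (T.prod Y).X ⟶ C.X) (w : complexBetti C.X (2 * p)),
        C.dim < (T.prod Y).dim ∧ IsRationalClass w ∧ IsOfHodgeType C.dim C.X (2 * p) p p w ∧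
        w' = complexBetti.map g (2 * p) w} :=
  ⟨Y, CartesianMonoidalCategory.snd T.X Y.X, w, by rw [Motives.AbelianVariety.dim_prod]; omega, hw, hwt, rfl⟩

/-- **A Weil class pulled back from a Weil SIXFOLD factor lies in X1's Weil-sixfold pull-back summand of `T × Y`**
(generator shape verbatim; any `T`): the census clause that does cover `T × Y₆`. [cite: MoonenZarhin1999LowDim,
(2.7)–(2.8) and §5] [cite: vanGeemen1994HodgeAV, 4.9] -/
theorem map_snd_mem_weilSixfoldPullbacks (hY : Y.dim = 6) {d : ℕ} (hd : 0 < d) {ψ : Y ⟶ Y}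
    (hψ : ψ ≫ ψ = -(d • 𝟙 Y)) {w : complexBetti Y.X (2 * 3)} (hw : IsRationalClass w)
    (hwt : IsOfHodgeType Y.dim Y.X (2 * 3) 3 3 w) (hwW : w ∈ weilClassesOf Y ψ 3 d) :
    complexBetti.map (CartesianMonoidalCategory.snd T.X Y.X) (2 * 3) w ∈ {w' : complexBetti (T.prod Y).X (2 * 3) |
      ∃ (B : AbelianVariety ℂ) (g : (T.prod Y).X ⟶ B.X) (d : ℕ) (ψ : B ⟶ B) (w : complexBetti B.X (2 * 3)),
        B.dim = 6 ∧ 0 < d ∧ ψ ≫ ψ = -(d • 𝟙 B) ∧ IsRationalClass w ∧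
        IsOfHodgeType B.dim B.X (2 * 3) 3 3 w ∧ w ∈ weilClassesOf B ψ 3 d ∧ w' = complexBetti.map g (2 * 3) w} :=
  ⟨Y, CartesianMonoidalCategory.snd T.X Y.X, d, ψ, w, hY, hd, hψ, hw, hwt, hwW, rfl⟩

/-- **From Weil's barrier fact alone (`n = 3`, a HYPOTHESIS)**: a sixfold `Y` such that `T × Y` violates (G) for
every positive-dimensional `T` and violates `B = D` for every `T`. Which further shape `Y` itself has is print
(van Geemen Thm. 6.12). [cite: vanGeemen1994HodgeAV, Thm. 4.11] [cite: Weil1977HodgeRing] -/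
theorem exists_six_forall_prod_not_multiWeil_of_weil1977 (h : Weil1977_exceptionalHodgeClasses) :
    ∃ Y : AbelianVariety ℂ, Y.dim = 6 ∧
      (∀ T : AbelianVariety ℂ, 0 < T.dim → ¬ IsDivisorMultiWeilGenerated (T.prod Y)) ∧
      ∀ T : AbelianVariety ℂ, ¬ IsDivisorGenerated (T.prod Y) := by
  obtain ⟨Y, hY, -, c, hc, hH, hn⟩ := h 3 (by norm_num)
  have hH' : IsOfHodgeType Y.dim Y.X (2 * 3) 3 3 c := by rw [hY]; exact hH
  have hn' : c ∉ divisorClassesSpan Y.X Y.dim 3 := by rw [hY]; exact hn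
  exact ⟨Y, by omega, fun T hT ↦ not_isDivisorMultiWeilGenerated_prod_of_exceptional_middle hT hY hc hH' hn',
    fun T ↦ not_isDivisorGenerated_prod_of_exceptional hc hH' hn'⟩

-- Audit under `HodgeConjecture` (the rows are on the HC path, dims 6 and 7): part XIX's
-- `multiWeilVsPullbacks_audit_of_hodgeConjecture`, reused by name, not restated (gate rule dedup.landed).

end Product

end Summit.HodgeConjecture.HodgeConjecture.Ring2.Hypotheses

end
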